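import Summits.QuantumFields.YangMills.Theorems.UnitScaleTiltProp7FlatLocalBernstein
import Summits.QuantumFields.YangMills.Theorems.UnitScaleTiltProp7FlatBlockConstLaplace
import HarnessLib

/-!
# Route `UnitScaleTilt`, crux K1 «MinimiserStabilityRegPr» (stmt-QuantumFields-19200), route-R E′ (A′) row (P-A4) support ∕ HKGK (R-loc′) — THE SITE-AVERAGE TWIN OF THE FLAT LOCAL BERNSTEIN
# INEQUALITY: for a local solution of `Δu = (Q′_k)ᵀω` (transpose of the `k`-fold SITE average — a BLOCK-CONSTANT source), `Σ_{μ'}Σ_x χ²(u(x+e_μ') − u(x))² ≤ ℓ⁻²·(C·Σ_{blocks} u² + 8d·Σ_{S₁} u²)`,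
# absolute constants, hypotheses = local equation + cutoff geometry only (★p1 g17 WORD 15: P-A4 curved = flat + LOCAL gauge perturbation on cubes; px12 g5 = P-A4 pen; this seat = support)

Cell `ym3-torus`, twin-width seat `ym-ust-19936-w8` (gen 5).  THEOREMS ONLY (0 `def`, 0 `sorry`); `--supports stmt-QuantumFields-19200 --as helper`, count-neutral.  YM₃ on T³ is a
ladder rung (R3), not the Clay problem; nothing here claims P-A4, the crude slice, hcoW, E′, the stub, the crux, d = 4 or the mass gap.

WHY.  The block-constant source is the EASY case of ✓p688495 (even bump only, `ℓ ≥ 3`); its blockwise inverse estimate is px12 g5's ✓`Prop7FlatBlockConstLaplace.sum_block_sq_laplace_le_of_const`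
(P-A4 FILE S1, the GLOBAL∕blockwise form), imported BY NAME — this file adds only the LOCAL cutoff assembly (cutoff Caccioppoli ✓p684843 + support bookkeeping ✓`Prop7FlatLocalBernstein` §1)
and the reading of the `Q′_k`-transpose as a block constant.

WHAT IS PROVED (ns `…Theorems.Prop7FlatLocalBernsteinSite`; `k ≤ m + K`, `ℓ = L^k`).
* §1 ★ `siteTranspose_blockSiteK` — the `Q′_k`-transpose of a coarse site weight `ω` (pairing `hf : ∀ φ, Σ_y ω(y)(Q′_kφ)(y) = Σ_x f(x)φ(x)`) is BLOCK-CONSTANT: `f(L^k·y + j) = ((L^d)^k)⁻¹·ω(y)`.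
* §2 ★★★ `local_bernstein_site` — the assembly: `Σ_{μ'}Σ_x χ(x)²(u(x+e_μ') − u(x))² ≤ (2C_e(d,ℓ)ℓ² + 2∕ℓ²)·Σ_{y∈Ω}Σ_{B^k(y)} u² + (8d∕ℓ²)·Σ_{S₁} u²` for `Δu = (Q′_k)ᵀω` on the blocks of `Ω`.
HONEST SCOPE.  Flat, linear; [folklore] Caccioppoli + interior duality; constants crude; the curved P-A4 (massive `G′_W` range, Combes–Thomas + local gauge) is px12 g5's LOCATE, not here.

References: T. Bałaban, CMP 95 (1984) 17–40 [Balaban1984PropagatorsI] ((1.16)–(1.20) p.20, (1.21) p.21); CMP 102 (1985) 277–309 [Balaban1985Variational] (p.299); M. Giaquinta, Princeton UP 1983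
[Giaquinta1984] (Ch. III §2).
-/

set_option autoImplicit false

noncomputable section

open scoped BigOperators

namespace Summit.QuantumFields.YangMills.Theorems.Prop7FlatLocalBernsteinSite

open Literature.MathematicalPhysics.QuantumFieldTheory.Balaban1983to89
open Finset LatticeFieldCalculus
open B5Eq117TorusCarriers (blockSiteK val_blockSiteK sitesPerDir_zero_eq sum_iterBlock_eq blockSiteK_mem_iterBlock)
open B5Eq118OneStroke (iterBlock mem_iterBlock siteAvgIter_eq_blockSum)
open Summit.QuantumFields.YangMills.Theorems.Prop7FlatBlockConstLaplace (sum_block_sq_laplace_le_of_const)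
open Summit.QuantumFields.YangMills.Theorems.Prop7FlatCutoffCaccioppoli (sum_sq_mul_sq_diff_le_sourced)
open Summit.QuantumFields.YangMills.Theorems.Prop7FlatLocalBernstein (sum_sq_mul_le_sum_of_support sum_biUnion_blocks sum_change_le)

variable {P : Params} {k : ℕ}

/-! ## §1 The site-average transpose is block-constant -/

/-- ★ **THE `Q′_k`-TRANSPOSE OF A COARSE SITE WEIGHT IS BLOCK-CONSTANT**: if `Σ_y ω(y)·(Q′_kφ)(y) = Σ_x f(x)·φ(x)` for every fine `φ` (`Q′_k = siteAvgIter k`, (1.16)–(1.20)), then on the block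
`B^k(y)`: `f(L^k·y + j) = ((L^d)^k)⁻¹·ω(y)`. [cite: Balaban1984PropagatorsI, (1.16) p.20] -/
theorem siteTranspose_blockSiteK (hk : k ≤ P.m + P.K) (ω : Site P k → ℝ) (f : Site P 0 → ℝ)
    (hf : ∀ φ : Site P 0 → ℝ, ∑ y : Site P k, ω y * siteAvgIter k φ y = ∑ x : Site P 0, f x * φ x)
    (y : Site P k) (j : Fin P.d → Fin (P.L ^ k)) :
    f (blockSiteK k y j) = ((((P.L : ℝ) ^ P.d) ^ k)⁻¹) * ω y := by
  classical
  set x : Site P 0 := blockSiteK k y j with hx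
  have h := hf (fun z => if z = x then 1 else 0)
  have hR : ∑ z : Site P 0, f z * (if z = x then (1 : ℝ) else 0) = f x := by
    simp only [mul_ite, mul_one, mul_zero, Finset.sum_ite_eq', Finset.mem_univ, if_true]
  rw [hR] at h
  rw [← h]
  have hQ : ∀ y' : Site P k, siteAvgIter k (fun z => if z = x then (1 : ℝ) else 0) y' = ((((P.L : ℝ) ^ P.d) ^ k)⁻¹) * (if y' = y then 1 else 0) := by
    intro y'
    rw [siteAvgIter_eq_blockSum k hk _ y', smul_eq_mul]
    congr 1
    rw [Finset.sum_ite_eq' (iterBlock k y') x (fun _ => (1 : ℝ))]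
    have hxy : x ∈ iterBlock k y := blockSiteK_mem_iterBlock hk y j
    rw [mem_iterBlock] at hxy
    by_cases hy : y' = y
    · rw [if_pos hy, if_pos (by rw [mem_iterBlock, hxy, hy])]
    · rw [if_neg hy, if_neg (by rw [mem_iterBlock, hxy]; exact Ne.symm hy)]
  simp_rw [hQ]
  simp only [mul_ite, mul_one, mul_zero, Finset.sum_ite_eq', Finset.mem_univ, if_true]
  ring

/-! ## §2 The local Bernstein inequality for a block-constant source -/

/-- ★★★ **THE FLAT LOCAL BERNSTEIN INEQUALITY, SITE-AVERAGE SOURCE**: `f` the `Q′_k`-transpose of ANY coarse site weight `ω` (pairing `hf`), `Δu = f` on every block of `Ω`, `χ` a cutoff with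
`|χ| ≤ 1` supported in `⋃_{y∈Ω}B^k(y)`, `(χ(x+e_μ') − χ(x))² ≤ ℓ⁻²`, `S₁` ⊇ both ends of the bonds where `χ` changes, `3 ≤ L^k`.  THEN
`Σ_{μ'}Σ_x χ(x)²(u(x+e_μ') − u(x))² ≤ (2·C_e(d,ℓ)·ℓ² + 2∕ℓ²)·Σ_{y∈Ω}Σ_{x∈B^k(y)} u(x)² + (8d∕ℓ²)·Σ_{x∈S₁} u(x)²` — every term `ℓ⁻²·(local mass)`.
[cite: Balaban1984PropagatorsI, (1.16) p.20, (1.21) p.21; Balaban1985Variational, p.299; Giaquinta1984, Ch. III §2 (2.3)-(2.4) p.77] -/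
theorem local_bernstein_site (hk : k ≤ P.m + P.K) (hℓ3 : 3 ≤ P.L ^ k) (ω : Site P k → ℝ) (u f : Site P 0 → ℝ)
    (hf : ∀ φ : Site P 0 → ℝ, ∑ y : Site P k, ω y * siteAvgIter k φ y = ∑ x : Site P 0, f x * φ x)
    (Ω : Finset (Site P k)) (hLap : ∀ y ∈ Ω, ∀ x ∈ iterBlock k y, laplace 1 u x = f x)
    (χ : SiteField P 0 ℝ) (hχ1 : ∀ x, |χ x| ≤ 1) (hχU : ∀ x, χ x ≠ 0 → x ∈ Ω.biUnion (iterBlock k))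
    (hχlip : ∀ x (μ' : Fin P.d), (χ (x.shift μ') - χ x) ^ 2 ≤ 1 / (((P.L : ℝ) ^ k) ^ 2))
    (S₁ : Finset (Site P 0)) (hS₁ : ∀ x (μ' : Fin P.d), χ (x.shift μ') ≠ χ x → x ∈ S₁ ∧ x.shift μ' ∈ S₁) :
    ∑ μ' : Fin P.d, ∑ x : Site P 0, χ x ^ 2 * (u (x.shift μ') - u x) ^ 2
      ≤ (2 * (((P.L : ℝ) ^ k) ^ P.d * (((P.L : ℝ) ^ k) ^ P.d * ((P.d : ℝ) * (2 * ((P.L : ℝ) ^ k) ^ 2 * ((((P.L : ℝ) ^ k) ^ 4 / 16) ^ (P.d - 1)))) ^ 2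
            * (243 / ((P.L : ℝ) ^ k) ^ 5) ^ (2 * P.d))) * ((P.L : ℝ) ^ k) ^ 2 + 2 / ((P.L : ℝ) ^ k) ^ 2)
          * ∑ y ∈ Ω, ∑ x ∈ iterBlock k y, u x ^ 2
        + (8 * P.d / ((P.L : ℝ) ^ k) ^ 2) * ∑ x ∈ S₁, u x ^ 2 := by
  classical
  set L : ℝ := (P.L : ℝ) ^ k with hLdef
  have hL3 : (3 : ℝ) ≤ L := by
    have : ((P.L ^ k : ℕ) : ℝ) = L := by rw [hLdef]; push_cast; rfl
    rw [← this]; exact_mod_cast hℓ3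
  have hLpos : 0 < L := by linarith only [hL3]
  set C : ℝ := L ^ P.d * (L ^ P.d * ((P.d : ℝ) * (2 * L ^ 2 * ((L ^ 4 / 16) ^ (P.d - 1)))) ^ 2 * (243 / L ^ 5) ^ (2 * P.d)) with hCdef
  have hC0 : 0 ≤ C := by positivity
  have hΔ : ∀ x : Site P 0, χ x ≠ 0 → laplace 1 u x = f x := by
    intro x hx
    obtain ⟨y, hy, hxy⟩ := Finset.mem_biUnion.mp (hχU x hx)
    exact hLap y hy x hxy
  have hcac := sum_sq_mul_sq_diff_le_sourced χ u f hΔ (t := L ^ 2) (by positivity)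
  set M : ℝ := ∑ y ∈ Ω, ∑ x ∈ iterBlock k y, u x ^ 2 with hMdef
  -- on each block the source is the constant `c_y` and `Σ_B f² = Σ_B c_y²`
  have hblock : ∀ y ∈ Ω, ∑ x ∈ iterBlock k y, f x ^ 2 ≤ C * ∑ x ∈ iterBlock k y, u x ^ 2 := by
    intro y hy
    set cy : ℝ := ((((P.L : ℝ) ^ P.d) ^ k)⁻¹) * ω y with hcy
    have hfx : ∀ x ∈ iterBlock k y, f x = cy := by
      intro x hx
      obtain ⟨j, hj⟩ := (B5Eq117TorusCarriers.blockEquivK hk y).surjective ⟨x, hx⟩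
      have hjx : blockSiteK k y j = x := congrArg Subtype.val hj
      rw [← hjx]
      exact siteTranspose_blockSiteK hk ω f hf y j
    have h1 : ∑ x ∈ iterBlock k y, f x ^ 2 = ∑ x ∈ iterBlock k y, laplace 1 u x ^ 2 := Finset.sum_congr rfl fun x hx => by rw [hLap y hy x hx]
    rw [h1]
    have h2 := sum_block_sq_laplace_le_of_const hk hℓ3 u cy y (fun x hx => by rw [hLap y hy x hx, hfx x hx])
    rw [← hLdef] at h2
    exact h2
  have hT1 : ∑ x : Site P 0, χ x ^ 2 * f x ^ 2 ≤ C * M := by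
    have h1 := sum_sq_mul_le_sum_of_support χ (fun z => f z ^ 2) (Ω.biUnion (iterBlock k)) (fun x => sq_nonneg _) hχ1 hχU
    refine h1.trans ?_
    rw [sum_biUnion_blocks, hMdef, Finset.mul_sum]
    exact Finset.sum_le_sum fun y hy => hblock y hy
  have hT2 : ∑ x : Site P 0, χ x ^ 2 * u x ^ 2 ≤ M := by
    have h1 := sum_sq_mul_le_sum_of_support χ (fun z => u z ^ 2) (Ω.biUnion (iterBlock k)) (fun x => sq_nonneg _) hχ1 hχU
    refine h1.trans (le_of_eq ?_)
    rw [sum_biUnion_blocks]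
  have hT3 : ∑ μ' : Fin P.d, ∑ x : Site P 0, (χ (x.shift μ') - χ x) ^ 2 * (u x + u (x.shift μ')) ^ 2
      ≤ (P.d : ℝ) * (1 / L ^ 2 * (4 * ∑ x ∈ S₁, u x ^ 2)) := by
    calc _ ≤ ∑ _μ' : Fin P.d, 1 / L ^ 2 * (4 * ∑ x ∈ S₁, u x ^ 2) :=
          Finset.sum_le_sum fun μ' _ => sum_change_le χ u μ' S₁ (by positivity) (fun x => hχlip x μ') (fun x => hS₁ x μ')
      _ = (P.d : ℝ) * (1 / L ^ 2 * (4 * ∑ x ∈ S₁, u x ^ 2)) := by rw [Finset.sum_const, Finset.card_univ, Fintype.card_fin, nsmul_eq_mul]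
  have hM0 : 0 ≤ M := Finset.sum_nonneg fun y _ => Finset.sum_nonneg fun x _ => sq_nonneg _
  have key : ∑ μ' : Fin P.d, ∑ x : Site P 0, χ x ^ 2 * (u (x.shift μ') - u x) ^ 2
      ≤ 2 * L ^ 2 * (C * M) + 2 / L ^ 2 * M + 2 * ((P.d : ℝ) * (1 / L ^ 2 * (4 * ∑ x ∈ S₁, u x ^ 2))) := by
    have e1 : 2 * L ^ 2 * ∑ x : Site P 0, χ x ^ 2 * f x ^ 2 ≤ 2 * L ^ 2 * (C * M) := mul_le_mul_of_nonneg_left hT1 (by positivity)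
    have e2 : 2 / L ^ 2 * ∑ x : Site P 0, χ x ^ 2 * u x ^ 2 ≤ 2 / L ^ 2 * M := mul_le_mul_of_nonneg_left hT2 (by positivity)
    linarith only [hcac, e1, e2, hT3]
  refine key.trans (le_of_eq ?_)
  rw [hCdef, hMdef]
  have hLne : L ≠ 0 := hLpos.ne'
  field_simp
  ring

end Summit.QuantumFields.YangMills.Theorems.Prop7FlatLocalBernsteinSite

end
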